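import Mathlib
import Literature.Probability.Percolation.QuadCrossingPathCrossings
import Literature.Probability.Percolation.QuadCrossingQuadTopology
import Literature.Probability.Percolation.QuadCrossingRawClosed
import Literature.Probability.LatticeModels.MeshColumns
import HarnessLib

/-!
# Local surgery on crossings of a quad by the open edges of `δℤ²`: topological toolkit, I

Helper file for the stub `stub_nonAxialShare_bulk` (D4-bulk) of the line `Sketch` (crux
`stmt-CriticalPhenomena-10269`, `…Theses.CardySelfRefinement.GradientComparability`): the
transfer of pivotality from an axial bulk edge to a non-axial edge of an adjacent cell is a
deterministic local modification of the configuration, and this file supplies the first half of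
the configuration-free plane topology it needs, for a quad `Q` and the drawn open edges
`openEdgeUnion δ ω` of a bond configuration `ω` of `ℤ²`:

* `openEdgeUnion_union`, `segment_subset_openEdgeUnion'`, `exists_adj_mem_of_meshPoint_mem`
  (a drawn lattice point of the drawing is the end of an open edge), `exists_vertex_of_mem_inter`
  (the drawings of two edge-disjoint configurations meet only at drawn common lattice ends);
* crossings are path crossings: `exists_isCrossing_iff_joinedIn`
  (via `joinedIn_inter_openEdgeUnion_of_isConnected`);
* first / last hitting times of a closed set along a continuous arc (`exists_first_hit`,
  `exists_last_hit`), sub-arcs join (`joinedIn_of_arc`);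
* **the three-way decomposition** `crossing_decomposition` (registered sub-goal): if
  `τ ∪ Sa ∪ Sb` crosses `Q`, where `Sa`, `Sb` are edge sets off `τ` whose drawings are disjoint
  from each other and from `∂₀Q ∪ ∂₂Q`, then `τ` alone crosses `Q`, or an end of `Sa` is joined
  to `∂₂Q` inside `[Q] ∩ openEdgeUnion δ τ`, or an end of `Sb` to `∂₀Q`, or an end of `Sa` to an
  end of `Sb` — the crossing path can enter the new drawings only through drawn lattice ends.

No percolation, no named fact.
-/

noncomputable section

namespace Summit.CriticalPhenomena.CardyFormulaZ2.Theorems.CardySelfRefinement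

open scoped Topology
open Filter Set MeasureTheory Metric
open Literature.Probability.LatticeModels Literature.Probability.Percolation
open Literature.Probability.Percolation.QuadCrossing

variable {D : Set ℂ} {δ : ℝ}

/-! ## Drawn open edges: algebra -/

/-- The drawing of a union of configurations is the union of the drawings. -/
theorem openEdgeUnion_union (δ : ℝ) (ω ω' : BondConfig (Site 2)) :
    openEdgeUnion δ (ω ∪ ω') = openEdgeUnion δ ω ∪ openEdgeUnion δ ω' := by
  ext z
  simp only [mem_openEdgeUnion_iff, Set.mem_union]
  constructor
  · rintro ⟨x, y, hxy, h | h, hz⟩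
    · exact Or.inl ⟨x, y, hxy, h, hz⟩
    · exact Or.inr ⟨x, y, hxy, h, hz⟩
  · rintro (⟨x, y, hxy, h, hz⟩ | ⟨x, y, hxy, h, hz⟩)
    · exact ⟨x, y, hxy, Or.inl h, hz⟩
    · exact ⟨x, y, hxy, Or.inr h, hz⟩

/-- The drawing of `ω` lies in the drawing of `ω'` together with that of `R` when `ω ⊆ ω' ∪ R`. -/
theorem openEdgeUnion_subset_union_of_subset (δ : ℝ) {ω ω' R : BondConfig (Site 2)}
    (h : ω ⊆ ω' ∪ R) : openEdgeUnion δ ω ⊆ openEdgeUnion δ ω' ∪ openEdgeUnion δ R := by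
  rw [← openEdgeUnion_union]
  exact openEdgeUnion_mono δ h

/-- The drawn segment of an open lattice edge lies in the drawing. -/
theorem segment_subset_openEdgeUnion' (δ : ℝ) {ω : BondConfig (Site 2)} {x y : Site 2}
    (hxy : (zdGraph 2).Adj x y) (h : s(x, y) ∈ ω) :
    segment ℝ (meshPoint δ x) (meshPoint δ y) ⊆ openEdgeUnion δ ω := fun _ hz =>
  mem_openEdgeUnion_iff.2 ⟨x, y, hxy, h, hz⟩

/-- A drawn lattice point lying in the drawing is the end of an open lattice edge. -/
theorem exists_adj_mem_of_meshPoint_mem (hδ : 0 < δ) {ω : BondConfig (Site 2)} {v : Site 2}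
    (h : meshPoint δ v ∈ openEdgeUnion δ ω) : ∃ y, (zdGraph 2).Adj v y ∧ s(v, y) ∈ ω := by
  obtain ⟨x, y, hxy, hω, hz⟩ := mem_openEdgeUnion_iff.1 h
  rcases Mesh.eq_or_eq_of_meshPoint_mem_segment hδ hxy hz with rfl | rfl
  · exact ⟨y, hxy, hω⟩
  · exact ⟨x, hxy.symm, by rw [Sym2.eq_swap]; exact hω⟩

/-- A point of the drawings of two edge-disjoint configurations is a drawn lattice point which is
an end of an open edge of each. -/
theorem exists_vertex_of_mem_inter (hδ : 0 < δ) {S T : BondConfig (Site 2)}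
    (hST : ∀ e ∈ S, e ∉ T) {z : ℂ} (hzS : z ∈ openEdgeUnion δ S) (hzT : z ∈ openEdgeUnion δ T) :
    ∃ v : Site 2, z = meshPoint δ v ∧ (∃ y, (zdGraph 2).Adj v y ∧ s(v, y) ∈ S) ∧
      ∃ y', (zdGraph 2).Adj v y' ∧ s(v, y') ∈ T := by
  obtain ⟨x, y, hxy, hS, hz⟩ := mem_openEdgeUnion_iff.1 hzS
  obtain ⟨x', y', hxy', hT, hz'⟩ := mem_openEdgeUnion_iff.1 hzT
  have hne : s(x, y) ≠ s(x', y') := fun h => hST _ hS (h ▸ hT)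
  obtain ⟨v, rfl, hv, hv'⟩ := exists_eq_meshPoint_of_mem_segment_inter hδ.ne' hxy hxy' hne hz hz'
  refine ⟨v, rfl, ?_, ?_⟩
  · rcases Sym2.mem_iff.1 hv with rfl | rfl
    · exact ⟨y, hxy, hS⟩
    · exact ⟨x, hxy.symm, by rw [Sym2.eq_swap]; exact hS⟩
  · rcases Sym2.mem_iff.1 hv' with rfl | rfl
    · exact ⟨y', hxy', hT⟩
    · exact ⟨x', hxy'.symm, by rw [Sym2.eq_swap]; exact hT⟩

/-! ## Crossings are path crossings -/

/-- `Q` has a crossing inside the drawn open edges iff some point of `∂₀Q` is joined to some point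
of `∂₂Q` by a path inside `[Q] ∩ openEdgeUnion δ ω` (`δ > 0`). -/
theorem exists_isCrossing_iff_joinedIn (hδ : 0 < δ) (Q : Quad D) (ω : BondConfig (Site 2)) :
    (∃ K, Q.IsCrossing K ∧ K ⊆ openEdgeUnion δ ω) ↔
      ∃ a ∈ Q.side 0, ∃ b ∈ Q.side 2, JoinedIn (Q.carrier ∩ openEdgeUnion δ ω) a b := by
  constructor
  · rintro ⟨K, ⟨hKc, hKconn, hKQ, ⟨a, haK, ha⟩, ⟨b, hbK, hb⟩⟩, hKO⟩
    exact ⟨a, ha, b, hb, joinedIn_inter_openEdgeUnion_of_isConnected hδ hKc hKconn hKO hKQ haK hbK⟩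
  · rintro ⟨a, ha, b, hb, hJ⟩
    set p := hJ.somePath
    refine ⟨Set.range p, ⟨isCompact_range p.continuous, isConnected_range p.continuous,
      fun z ⟨t, ht⟩ => ht ▸ (hJ.somePath_mem t).1, ⟨a, ⟨0, p.source⟩, ha⟩, ⟨b, ⟨1, p.target⟩, hb⟩⟩,
      fun z ⟨t, ht⟩ => ht ▸ (hJ.somePath_mem t).2⟩

/-- A point joined inside `[Q] ∩ openEdgeUnion δ ω` to `∂₀Q` and to `∂₂Q` yields a crossing. -/
theorem exists_isCrossing_of_joinedIn_two_sides (hδ : 0 < δ) (Q : Quad D)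
    {ω : BondConfig (Site 2)} {z : ℂ} (h0 : ∃ a ∈ Q.side 0, JoinedIn (Q.carrier ∩ openEdgeUnion δ ω) a z)
    (h2 : ∃ b ∈ Q.side 2, JoinedIn (Q.carrier ∩ openEdgeUnion δ ω) b z) :
    ∃ K, Q.IsCrossing K ∧ K ⊆ openEdgeUnion δ ω := by
  obtain ⟨a, ha, hJa⟩ := h0
  obtain ⟨b, hb, hJb⟩ := h2
  exact (exists_isCrossing_iff_joinedIn hδ Q ω).2 ⟨a, ha, b, hb, hJa.trans hJb.symm⟩

/-- The two ends of an open lattice edge drawn inside `[Q]` are joined. -/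
theorem joinedIn_of_adj_mem (δ : ℝ) (Q : Quad D) {ω : BondConfig (Site 2)} {x y : Site 2}
    (hxy : (zdGraph 2).Adj x y) (h : s(x, y) ∈ ω)
    (hQ : segment ℝ (meshPoint δ x) (meshPoint δ y) ⊆ Q.carrier) :
    JoinedIn (Q.carrier ∩ openEdgeUnion δ ω) (meshPoint δ x) (meshPoint δ y) :=
  JoinedIn.of_segment_subset (Set.subset_inter hQ (segment_subset_openEdgeUnion' δ hxy h))

/-! ## Hitting times of a closed set along an arc -/

/-- **First hit.**  A continuous arc `γ` on `[lo, hi]` covered by the closed sets `O ∪ A`, starting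
off `A` and ending in `A`, first hits `A` at a time `t > lo`, up to which it stays inside `O`. -/
theorem exists_first_hit {γ : ℝ → ℂ} (hγ : Continuous γ) {O A : Set ℂ} (hO : IsClosed O)
    (hA : IsClosed A) {lo hi : ℝ} (hle : lo ≤ hi) (hcov : ∀ u ∈ Icc lo hi, γ u ∈ O ∪ A)
    (hlo : γ lo ∉ A) (hhi : γ hi ∈ A) :
    ∃ t ∈ Ioc lo hi, γ t ∈ A ∧ ∀ u ∈ Icc lo t, γ u ∈ O := by
  set T : Set ℝ := Icc lo hi ∩ γ ⁻¹' A with hT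
  have hTc : IsClosed T := isClosed_Icc.inter (hA.preimage hγ)
  have hTne : T.Nonempty := ⟨hi, right_mem_Icc.2 hle, hhi⟩
  have hTbdd : BddBelow T := ⟨lo, fun u hu => hu.1.1⟩
  set t := sInf T with ht
  have htT : t ∈ T := hTc.csInf_mem hTne hTbdd
  have hlt : lo < t := by
    rcases eq_or_lt_of_le htT.1.1 with h | h
    · exact absurd (h ▸ htT.2 : γ lo ∈ A) hlo
    · exact h
  -- before `t` the arc avoids `A`, hence lies in `O`
  have hbefore : ∀ u ∈ Ico lo t, γ u ∈ O := fun u hu => by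
    have huA : γ u ∉ A := fun h => by
      have : t ≤ u := csInf_le hTbdd ⟨⟨hu.1, hu.2.le.trans htT.1.2⟩, h⟩
      exact absurd this (not_le.2 hu.2)
    exact (hcov u ⟨hu.1, hu.2.le.trans htT.1.2⟩).resolve_right huA
  have htO : γ t ∈ O := by
    have hmem : t ∈ closure (Ico lo t) := by
      rw [closure_Ico hlt.ne]; exact right_mem_Icc.2 hlt.le
    have himg : γ t ∈ closure (γ '' Ico lo t) := hγ.continuousWithinAt.mem_closure_image hmem
    exact hO.closure_subset_iff.2 (Set.image_subset_iff.2 fun x hx => hbefore x hx) himg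
  refine ⟨t, ⟨hlt, htT.1.2⟩, htT.2, fun u hu => ?_⟩
  rcases eq_or_lt_of_le hu.2 with h | hut
  · rw [h]; exact htO
  · exact hbefore u ⟨hu.1, hut⟩

/-- **Last hit.**  A continuous arc `γ` on `[lo, hi]` covered by the closed sets `O ∪ A`,
starting in `A` and ending off `A`, last hits `A` at a time `t < hi`, from which on it stays
inside `O`. -/
theorem exists_last_hit {γ : ℝ → ℂ} (hγ : Continuous γ) {O A : Set ℂ} (hO : IsClosed O)
    (hA : IsClosed A) {lo hi : ℝ} (hle : lo ≤ hi) (hcov : ∀ u ∈ Icc lo hi, γ u ∈ O ∪ A)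
    (hlo : γ lo ∈ A) (hhi : γ hi ∉ A) :
    ∃ t ∈ Ico lo hi, γ t ∈ A ∧ ∀ u ∈ Icc t hi, γ u ∈ O := by
  set T : Set ℝ := Icc lo hi ∩ γ ⁻¹' A with hT
  have hTc : IsClosed T := isClosed_Icc.inter (hA.preimage hγ)
  have hTne : T.Nonempty := ⟨lo, left_mem_Icc.2 hle, hlo⟩
  have hTbdd : BddAbove T := ⟨hi, fun u hu => hu.1.2⟩
  set t := sSup T with ht
  have htT : t ∈ T := hTc.csSup_mem hTne hTbdd
  have hlt : t < hi := by
    rcases eq_or_lt_of_le htT.1.2 with h | h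
    · exact absurd (h ▸ htT.2 : γ hi ∈ A) hhi
    · exact h
  have hafter : ∀ u ∈ Ioc t hi, γ u ∈ O := fun u hu => by
    have huA : γ u ∉ A := fun h => by
      have : u ≤ t := le_csSup hTbdd ⟨⟨htT.1.1.trans hu.1.le, hu.2⟩, h⟩
      exact absurd this (not_le.2 hu.1)
    exact (hcov u ⟨htT.1.1.trans hu.1.le, hu.2⟩).resolve_right huA
  have htO : γ t ∈ O := by
    have hmem : t ∈ closure (Ioc t hi) := by
      rw [closure_Ioc hlt.ne]; exact left_mem_Icc.2 hlt.le
    have himg : γ t ∈ closure (γ '' Ioc t hi) := hγ.continuousWithinAt.mem_closure_image hmem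
    exact hO.closure_subset_iff.2 (Set.image_subset_iff.2 fun x hx => hafter x hx) himg
  refine ⟨t, ⟨htT.1.1, hlt⟩, htT.2, fun u hu => ?_⟩
  rcases eq_or_lt_of_le hu.1 with h | htu
  · rw [← h]; exact htO
  · exact hafter u ⟨htu, hu.2⟩

/-- A sub-arc of a continuous arc inside `F` joins its ends inside `F`. -/
theorem joinedIn_of_arc {γ : ℝ → ℂ} (hγ : Continuous γ) {F : Set ℂ} {s t : ℝ} (hst : s ≤ t)
    (h : ∀ u ∈ Icc s t, γ u ∈ F) : JoinedIn F (γ s) (γ t) := by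
  have hpc : IsPathConnected (γ '' Icc s t) :=
    ((convex_Icc s t).isPathConnected ⟨s, left_mem_Icc.2 hst⟩).image hγ
  exact (hpc.joinedIn _ (Set.mem_image_of_mem γ (left_mem_Icc.2 hst)) _
    (Set.mem_image_of_mem γ (right_mem_Icc.2 hst))).mono (Set.image_subset_iff.2 h)

/-! ## The three-way decomposition of a crossing through new bulk edges -/

/-- **Three-way decomposition.**  Let `τ` be a configuration and `Sa`, `Sb` two further sets of
edges, not in `τ`, whose drawings are disjoint from each other and from `∂₀Q ∪ ∂₂Q`.  If
`τ ∪ Sa ∪ Sb` crosses `Q` (path form), then either `τ` alone crosses `Q`, or some end of an edge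
of `Sa` is joined to `∂₂Q` inside `[Q] ∩ openEdgeUnion δ τ`, or some end of an edge of `Sb` is
so joined to `∂₀Q`, or an end of `Sa` is so joined to an end of `Sb` (first and last visits of the
crossing path to the new drawings, which it can enter only through drawn lattice ends). -/
theorem crossing_decomposition {D : Set ℂ} {δ : ℝ} (hδ : 0 < δ) (Q : Quad D) {τ Sa Sb : BondConfig (Site 2)}
    (hτa : ∀ e ∈ Sa, e ∉ τ) (hτb : ∀ e ∈ Sb, e ∉ τ)
    (hAB : ∀ z ∈ openEdgeUnion δ Sa, z ∉ openEdgeUnion δ Sb)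
    (hbulk : ∀ z ∈ openEdgeUnion δ (Sa ∪ Sb), z ∉ Q.side 0 ∧ z ∉ Q.side 2)
    (hcr : ∃ a ∈ Q.side 0, ∃ b ∈ Q.side 2,
      JoinedIn (Q.carrier ∩ openEdgeUnion δ (τ ∪ Sa ∪ Sb)) a b) :
    (∃ a ∈ Q.side 0, ∃ b ∈ Q.side 2, JoinedIn (Q.carrier ∩ openEdgeUnion δ τ) a b) ∨
    (∃ x, (∃ x', (zdGraph 2).Adj x x' ∧ s(x, x') ∈ Sa) ∧
        ∃ b ∈ Q.side 2, JoinedIn (Q.carrier ∩ openEdgeUnion δ τ) b (meshPoint δ x)) ∨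
    (∃ y, (∃ y', (zdGraph 2).Adj y y' ∧ s(y, y') ∈ Sb) ∧
        ∃ a ∈ Q.side 0, JoinedIn (Q.carrier ∩ openEdgeUnion δ τ) a (meshPoint δ y)) ∨
    (∃ x y, (∃ x', (zdGraph 2).Adj x x' ∧ s(x, x') ∈ Sa) ∧
        (∃ y', (zdGraph 2).Adj y y' ∧ s(y, y') ∈ Sb) ∧
        JoinedIn (Q.carrier ∩ openEdgeUnion δ τ) (meshPoint δ x) (meshPoint δ y)) := by
  obtain ⟨a, ha, b, hb, hJ⟩ := hcr
  set p := hJ.somePath with hp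
  set γ : ℝ → ℂ := ⇑p.extend with hγdef
  have hγc : Continuous γ := p.continuous_extend
  set O := openEdgeUnion δ τ with hOdef
  set A := openEdgeUnion δ Sa with hAdef
  set B := openEdgeUnion δ Sb with hBdef
  have hOc : IsClosed O := isClosed_openEdgeUnion hδ τ
  have hAc : IsClosed A := isClosed_openEdgeUnion hδ Sa
  have hBc : IsClosed B := isClosed_openEdgeUnion hδ Sb
  have hABc : IsClosed (A ∪ B) := hAc.union hBc
  have hAB' : openEdgeUnion δ (Sa ∪ Sb) = A ∪ B := openEdgeUnion_union δ Sa Sb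
  have hγmem : ∀ u, γ u ∈ Q.carrier ∧ γ u ∈ O ∪ (A ∪ B) := fun u => by
    have h1 : γ u ∈ Set.range p := by rw [← p.extend_range]; exact ⟨u, rfl⟩
    obtain ⟨t, ht⟩ := h1
    have h2 := hJ.somePath_mem t
    rw [← hp, ht, openEdgeUnion_union, openEdgeUnion_union, Set.union_assoc] at h2
    exact h2
  have hγ0 : γ 0 = a := p.extend_zero
  have hγ1 : γ 1 = b := p.extend_one
  have ha' : γ 0 ∉ A ∪ B := fun h => (hbulk _ (hAB' ▸ h)).1 (hγ0 ▸ ha)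
  have hb' : γ 1 ∉ A ∪ B := fun h => (hbulk _ (hAB' ▸ h)).2 (hγ1 ▸ hb)
  by_cases hhit : ∃ u ∈ Icc (0 : ℝ) 1, γ u ∈ A ∪ B
  swap
  · -- the path never meets the new drawings: it is a crossing of `τ`
    left
    push Not at hhit
    refine ⟨a, ha, b, hb, ?_⟩
    have := joinedIn_of_arc (F := Q.carrier ∩ O) hγc zero_le_one
      (fun u hu => (⟨(hγmem u).1, (hγmem u).2.resolve_right (hhit u hu)⟩ : γ u ∈ Q.carrier ∩ O))
    rwa [hγ0, hγ1] at this
  obtain ⟨w, hw, hγw⟩ := hhit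
  -- first hit `s₀` of `A ∪ B`
  obtain ⟨s₀, hs₀, hγs₀, hO₀⟩ :=
    exists_first_hit hγc hOc hABc hw.1 (fun u _ => (hγmem u).2) ha' hγw
  have hs₀O : γ s₀ ∈ O := hO₀ s₀ (right_mem_Icc.2 hs₀.1.le)
  have hJ₀ : JoinedIn (Q.carrier ∩ O) a (γ s₀) := by
    have := joinedIn_of_arc (F := Q.carrier ∩ O) hγc hs₀.1.le
      (fun u hu => (⟨(hγmem u).1, hO₀ u hu⟩ : γ u ∈ Q.carrier ∩ O))
    rwa [hγ0] at this
  have hs₀1 : s₀ ≤ 1 := hs₀.2.trans hw.2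
  rcases hγs₀ with hs₀A | hs₀B
  swap
  · -- first hit in `B`: an end of `Sb` joined to `∂₀Q`
    obtain ⟨y, hy, hySb, -⟩ := exists_vertex_of_mem_inter hδ hτb hs₀B hs₀O
    exact Or.inr (Or.inr (Or.inl ⟨y, hySb, a, ha, hy ▸ hJ₀⟩))
  -- last hit `u₀` of `A ∪ B` after `s₀`
  obtain ⟨u₀, hu₀, hγu₀, hO₁⟩ :=
    exists_last_hit hγc hOc hABc hs₀1 (fun u _ => (hγmem u).2) (Or.inl hs₀A) hb'
  have hu₀O : γ u₀ ∈ O := hO₁ u₀ (left_mem_Icc.2 hu₀.2.le)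
  have hJ₁ : JoinedIn (Q.carrier ∩ O) b (γ u₀) := by
    have := joinedIn_of_arc (F := Q.carrier ∩ O) hγc hu₀.2.le
      (fun u hu => (⟨(hγmem u).1, hO₁ u hu⟩ : γ u ∈ Q.carrier ∩ O))
    rw [hγ1] at this
    exact this.symm
  rcases hγu₀ with hu₀A | hu₀B
  · -- last hit in `A`: an end of `Sa` joined to `∂₂Q`
    obtain ⟨x, hx, hxSa, -⟩ := exists_vertex_of_mem_inter hδ hτa hu₀A hu₀O
    exact Or.inr (Or.inl ⟨x, hxSa, b, hb, hx ▸ hJ₁⟩)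
  -- middle: last hit `u₁` of `A` on `[s₀, u₀]`, then first hit `s₁` of `B` on `[u₁, u₀]`
  have hu₀nA : γ u₀ ∉ A := fun h => hAB _ h hu₀B
  obtain ⟨u₁, hu₁, hγu₁, hOB⟩ := exists_last_hit hγc (hOc.union hBc) hAc hu₀.1
    (fun u _ => by
      rcases (hγmem u).2 with h | h | h
      exacts [Or.inl (Or.inl h), Or.inr h, Or.inl (Or.inr h)]) hs₀A hu₀nA
  have hu₁nB : γ u₁ ∉ B := fun h => hAB _ hγu₁ h
  obtain ⟨s₁, hs₁, hγs₁, hO₂⟩ :=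
    exists_first_hit hγc hOc hBc hu₁.2.le (fun u hu => hOB u hu) hu₁nB hu₀B
  have hu₁O : γ u₁ ∈ O := hO₂ u₁ (left_mem_Icc.2 hs₁.1.le)
  have hs₁O : γ s₁ ∈ O := hO₂ s₁ (right_mem_Icc.2 hs₁.1.le)
  obtain ⟨x, hx, hxSa, -⟩ := exists_vertex_of_mem_inter hδ hτa hγu₁ hu₁O
  obtain ⟨y, hy, hySb, -⟩ := exists_vertex_of_mem_inter hδ hτb hγs₁ hs₁O
  refine Or.inr (Or.inr (Or.inr ⟨x, y, hxSa, hySb, ?_⟩))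
  have := joinedIn_of_arc (F := Q.carrier ∩ O) hγc hs₁.1.le
    (fun u hu => (⟨(hγmem u).1, hO₂ u hu⟩ : γ u ∈ Q.carrier ∩ O))
  rwa [hx, hy] at this

end Summit.CriticalPhenomena.CardyFormulaZ2.Theorems.CardySelfRefinement

end
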